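import Summits.MatrixMultiplication.MatrixMultiplication.Theorems.SaturationLadderCurvilinearKronecker
import HarnessLib

/-!
# SaturationLadder — the curvilinear pencil is exactly multiplicative: `P_M ⊵ P_m^{⊠N} ⟺ m^N ≤ M`

Support kernel K42b for route `SaturationLadder`, item `SubexpSaturation` (stmt-MatrixMultiplication-25909),
decomp-mm lens 1 gen 42; proofs only.  `P_m = truncPolyMulTensor K m = Str(K[t]/(t^m))`,
`(P_m) z x y = [x + y = z]` (BCS Ex. (15.20)).

K42 (`SaturationLadderCurvilinearKronecker`) proved the degenerations `P_{ab} ⊵ P_a ⊠ P_b`,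
`P_{m^N} ⊵ P_m^{⊠N}` and the exact threshold for Coppersmith–Winograd powers.  This file adds the
converse inequalities for the pencil itself, all from the flattening rank `ζ⁽¹⁾` (CVZ 2023, Ex. 1.4):

* `flatteningRank_truncPolyMulTensor` — `ζ⁽¹⁾(P_m) = m` over every field (the slices `z ↦ [x+y=z]`
  are linearly independent: evaluate at `(x, y) = (0, z)`), hence `m ≤ R̃(P_m)` and `ζ⁽¹⁾(P_m^{⊠N}) = m^N`;
* `asymptoticRank_truncPolyMulTensor_complex` — **`R̃(Str(ℂ[t]/(t^M))) = M`** (`M = ζ⁽¹⁾ ≤ R̃ ≤ R̲ = M`,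
  the last by the tree's `algBorderRank_truncPolyMulTensor`, BCS (15.26)/(15.20));
* `truncPolyMulTensor_polyDegeneratesTo_iff` — `P_M ⊵ P_m ⟺ m ≤ M`;
  `truncPolyMulTensor_polyDegeneratesTo_kronecker_iff` — `P_M ⊵ P_a ⊠ P_b ⟺ ab ≤ M`;
  `truncPolyMulTensor_polyDegeneratesTo_kroneckerPow_iff` — **`P_M ⊵ P_m^{⊠N} ⟺ m^N ≤ M`** (over `ℂ`).

So, up to degeneration, the pencil `(P_M)_M` is totally ordered by `M`, closed under `⊠` with the index
multiplying exactly, and (K41/K42) contains every Kronecker power of every (split or genuine) big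
Coppersmith–Winograd tensor at the index equal to its border rank.  [cite: BurgisserClausenShokrollahi1997,
Ex. (15.20), Lemma (15.26), Prop. (15.30); ChristandlVranaZuiddam2023, Example 1.4; Alman2021, §2.4, §4.1]
-/

set_option linter.dupNamespace false

noncomputable section

open scoped BigOperators

namespace Summit.MatrixMultiplication.MatrixMultiplication.Theorems.SaturationLadderCurvilinearKroneckerThreshold

open Literature.Computability.AlgebraicComplexity Literature.Barriers.MatrixMultiplication
open Summit.MatrixMultiplication.MatrixMultiplication.Theorems.SaturationLadderCurvilinearKronecker

universe u

/-! ## 1. Flattening rank of the pencil -/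

section Flattening

variable {K : Type u} [Field K]

/-- **`ζ⁽¹⁾(P_m) = m`**: the `m` slices `z ↦ ((x, y) ↦ [x + y = z])` of `Str(K[t]/(t^m))` are linearly
independent (evaluate a vanishing combination at `(x, y) = (0, z)`), i.e. `P_m` is `1`-concise.
[cite: BurgisserClausenShokrollahi1997, Ex. (15.20); ChristandlVranaZuiddam2023, Example 1.4] -/
theorem flatteningRank_truncPolyMulTensor (m : ℕ) : flatteningRank (truncPolyMulTensor K m) = m := by
  have hli : LinearIndependent K (xSlices (truncPolyMulTensor K m)) := by
    rw [Fintype.linearIndependent_iff]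
    intro g hg a
    have hev : ∀ x y : Fin m, (∑ i, g i * truncPolyMulTensor K m i x y) = 0 := by
      intro x y
      have := congrFun hg (x, y)
      simpa [Finset.sum_apply, Pi.smul_apply, xSlices_apply, smul_eq_mul] using this
    have h := hev ⟨0, Fin.pos a⟩ a
    rw [Finset.sum_eq_single a] at h
    · simpa using h
    · intro i _ hi
      have hne : ¬ ((a : ℕ) = (i : ℕ)) := fun h' => hi (Fin.ext h'.symm)
      simp [hne]
    · simp
  unfold flatteningRank
  rw [finrank_span_eq_card hli, Fintype.card_fin]

/-- `m ≤ R̃(Str(K[t]/(t^m)))` over every field (`ζ⁽¹⁾ ≤ R̃`, Alman 2021 §4.1 / CVZ 2023 Ex. 1.4).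
[cite: ChristandlVranaZuiddam2023, Example 1.4; Alman2021, §4.1] -/
theorem le_asymptoticRank_truncPolyMulTensor (m : ℕ) :
    (m : ℝ) ≤ asymptoticRank (truncPolyMulTensor K m) := by
  have := flatteningRank_le_asymptoticRank (truncPolyMulTensor K m)
  rw [flatteningRank_truncPolyMulTensor] at this
  exact_mod_cast this

/-- `ζ⁽¹⁾(P_m^{⊠N}) = m^N`. [cite: ChristandlVranaZuiddam2023, Example 1.4] -/
theorem flatteningRank_kroneckerPow_truncPolyMulTensor (m N : ℕ) :
    flatteningRank (kroneckerPow (truncPolyMulTensor K m) N) = m ^ N := by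
  rw [flatteningRank_kroneckerPow, flatteningRank_truncPolyMulTensor]

/-- `ζ⁽¹⁾(P_a ⊠ P_b) = ab`. [cite: ChristandlVranaZuiddam2023, Example 1.4] -/
theorem flatteningRank_kronecker_truncPolyMulTensor (a b : ℕ) :
    flatteningRank (kroneckerTensor (truncPolyMulTensor K a) (truncPolyMulTensor K b)) = a * b := by
  rw [flatteningRank_kronecker, flatteningRank_truncPolyMulTensor, flatteningRank_truncPolyMulTensor]

end Flattening

/-! ## 2. Over `ℂ`: `R̃(P_M) = M` and the exact thresholds -/

section Complex

/-- **`R̃(Str(ℂ[t]/(t^M))) = M`**: `M = ζ⁽¹⁾(P_M) ≤ R̃(P_M) ≤ R̲(P_M) = M`.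
[cite: BurgisserClausenShokrollahi1997, Ex. (15.20), Lemma (15.26); ChristandlVranaZuiddam2023, Example 1.4] -/
theorem asymptoticRank_truncPolyMulTensor_complex (M : ℕ) :
    asymptoticRank (truncPolyMulTensor ℂ M) = M := by
  classical
  refine le_antisymm ?_ (le_asymptoticRank_truncPolyMulTensor M)
  rcases Nat.eq_zero_or_pos M with rfl | hM
  · have h4 : asymptoticRank (truncPolyMulTensor ℂ 0) = 0 := asymptoticRank_eq_zero_of_isEmpty _
    rw [h4]
    simp
  · have := asymptoticRank_le_algBorderRank (truncPolyMulTensor ℂ M)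
    rwa [algBorderRank_truncPolyMulTensor (Complex.isPrimitiveRoot_exp M hM.ne') hM] at this

/-- **`P_M ⊵ P_m ⟺ m ≤ M`**: up to degeneration the pencil is totally ordered exactly by its index.
[cite: BurgisserClausenShokrollahi1997, Ex. (15.20), Lemma (15.26), (15.27); ChristandlVranaZuiddam2023, Example 1.4] -/
theorem truncPolyMulTensor_polyDegeneratesTo_iff (M m : ℕ) :
    PolyDegeneratesTo (truncPolyMulTensor ℂ M) (truncPolyMulTensor ℂ m) ↔ m ≤ M := by
  classical
  constructor
  · intro h
    have h3 := asymptoticRank_le_of_polyDegeneratesTo h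
    rw [asymptoticRank_truncPolyMulTensor_complex, asymptoticRank_truncPolyMulTensor_complex] at h3
    exact_mod_cast h3
  · intro hM
    exact (truncPolyMulTensor_restrictsTo_of_le ℂ hM).polyDegeneratesTo

/-- **`P_M ⊵ P_a ⊠ P_b ⟺ ab ≤ M`** over `ℂ` (`⇐` is K42's carry-free monomial degeneration).
[cite: BurgisserClausenShokrollahi1997, Prop. (15.30), Lemma (15.26); ChristandlVranaZuiddam2023, Example 1.4] -/
theorem truncPolyMulTensor_polyDegeneratesTo_kronecker_iff (M a b : ℕ) :
    PolyDegeneratesTo (truncPolyMulTensor ℂ M)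
      (kroneckerTensor (truncPolyMulTensor ℂ a) (truncPolyMulTensor ℂ b)) ↔ a * b ≤ M := by
  classical
  constructor
  · intro h
    have h1 : ((a * b : ℕ) : ℝ) ≤
        asymptoticRank (kroneckerTensor (truncPolyMulTensor ℂ a) (truncPolyMulTensor ℂ b)) := by
      have := flatteningRank_le_asymptoticRank
        (kroneckerTensor (truncPolyMulTensor ℂ a) (truncPolyMulTensor ℂ b))
      rwa [flatteningRank_kronecker_truncPolyMulTensor] at this
    have h3 := asymptoticRank_le_of_polyDegeneratesTo h
    rw [asymptoticRank_truncPolyMulTensor_complex] at h3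
    exact_mod_cast h1.trans h3
  · intro hM
    exact (truncPolyMulTensor_restrictsTo_of_le ℂ hM).polyDegeneratesTo.trans
      (truncPolyMulTensor_polyDegeneratesTo_kronecker ℂ a b)

/-- **Exact multiplicativity of the pencil: `P_M ⊵ P_m^{⊠N} ⟺ m^N ≤ M`** over `ℂ`
(`⇐`: K42's `P_{m^N} ⊵ P_m^{⊠N}` after restricting `P_M` to `P_{m^N}`; `⇒`: `m^N = ζ⁽¹⁾(P_m^{⊠N}) ≤
R̃(P_m^{⊠N}) ≤ R̃(P_M) = M`). [cite: BurgisserClausenShokrollahi1997, Prop. (15.30), Lemma (15.26), (15.27);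
ChristandlVranaZuiddam2023, Example 1.4; Alman2021, §2.4] -/
theorem truncPolyMulTensor_polyDegeneratesTo_kroneckerPow_iff (M m N : ℕ) :
    PolyDegeneratesTo (truncPolyMulTensor ℂ M) (kroneckerPow (truncPolyMulTensor ℂ m) N) ↔ m ^ N ≤ M := by
  classical
  constructor
  · intro h
    have h1 : ((m ^ N : ℕ) : ℝ) ≤ asymptoticRank (kroneckerPow (truncPolyMulTensor ℂ m) N) := by
      have := flatteningRank_le_asymptoticRank (kroneckerPow (truncPolyMulTensor ℂ m) N)
      rwa [flatteningRank_kroneckerPow_truncPolyMulTensor] at this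
    have h3 := asymptoticRank_le_of_polyDegeneratesTo h
    rw [asymptoticRank_truncPolyMulTensor_complex] at h3
    exact_mod_cast h1.trans h3
  · intro hM
    exact (truncPolyMulTensor_restrictsTo_of_le ℂ hM).polyDegeneratesTo.trans
      (truncPolyMulTensor_pow_polyDegeneratesTo_kroneckerPow ℂ m N)

/-- `R̃(P_m^{⊠N}) = m^N` over `ℂ`. [cite: BurgisserClausenShokrollahi1997, Prop. (15.30); ChristandlVranaZuiddam2023, Example 1.4] -/
theorem asymptoticRank_kroneckerPow_truncPolyMulTensor_complex (m N : ℕ) :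
    asymptoticRank (kroneckerPow (truncPolyMulTensor ℂ m) N) = (m : ℝ) ^ N := by
  classical
  refine le_antisymm ?_ ?_
  · have h := asymptoticRank_le_of_polyDegeneratesTo
      (truncPolyMulTensor_pow_polyDegeneratesTo_kroneckerPow ℂ m N)
    rw [asymptoticRank_truncPolyMulTensor_complex] at h
    exact_mod_cast h
  · have := flatteningRank_le_asymptoticRank (kroneckerPow (truncPolyMulTensor ℂ m) N)
    rw [flatteningRank_kroneckerPow_truncPolyMulTensor] at this
    exact_mod_cast this

end Complex

end Summit.MatrixMultiplication.MatrixMultiplication.Theorems.SaturationLadderCurvilinearKroneckerThreshold
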